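import Summits.AtomisticToContinuum.Crystallization.Theorems.OverbindingBudgetAffineCompressedCutPatch

/-!
# Overbinding budget — compressed cut: R4 «LR(r₁)» IV — ONE TYPE, ONE COPY PER PATCH; the box climb from every aligned copy

Record: route `OverbindingBudget`, crux `RobustDefectLimitWindows` (stmt-AtomisticToContinuum-31280); open leaf NS♭₂ ⟸ 79K ⟸ LR(r₁); R4 «LR(r₁)».
Continuation of `…CompressedCutPatch`.

* §1 `box_descent` — the box `InBox o K` is coordinatewise convex: from a layer point `x ≠ s` of the box a basal step `3(e_j − e_i)` toward `s`
  stays in the box and lowers the hex distance to `s` by one.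
* §2 ★★ `patch_uniform` — REPLACES `…StackTwo.disc_uniform` (whose reach / gap inequalities cannot be met at the record): TYPE PROPAGATION.  If
  every layer point of a box labels an established site charted onto `Qa` (if fcc) or onto `Qb ∈ {H, H′}` (if hcp), and sites at one label are
  identified (`D⁺ + D < ν`), then ONE copy serves for the whole box: an hcp site charted onto `H`/`H′` forces the site at every adjacent basal
  label to be hcp (one-parent rows E1, `kernelOneB H·/H′ hexL fccL []`, via `…Establish.estab_child_one`; identification `…SeedTwo.estab_site_unique`;
  `…Seed.fcc_ne_hcp`), and the box is hex-connected (`box_descent`).  No chart-resolution (`hgap`) and no reach (`hreach`) hypothesis.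
* §3 ★ `layer_climb_box_four` — `…Patch.layer_climb_box` from every aligned copy `F⁺, F⁻, H, H′` and either side, with the record tables
  (in-layer rows KF / `kfNeg_fcc` / E1, two-parent rows `up_*`, cap signs `ε` by `cap_shape`); output: the cap sign, the two singleton copies of the
  rows, and the child box.

Deps: `…CompressedCutPatch`.  No `instance`, no `notation`, no `set_option`, no new axioms, 0 sorry.
-/

namespace Summit.AtomisticToContinuum.Crystallization.Theorems.OverbindingBudgetAffineCompressedCutPatchTwo

open Literature.Geometry.DiscreteGeometry (nearestDist nearestDist_nonneg fccTwoShellPattern hcpTwoShellPattern)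
open Summit.AtomisticToContinuum.Crystallization.Theorems.OverbindingBudgetAffineCompressedCutKernel (T3 tsub tadd tneg tsq thsum tdet fccL hcpL
  fccNegL hcpAltL hexL capL kernelOneB kernelTwoB fccShellL kf_fcc e1_entries up_hcp_pos_fcc up_hcp_pos_hcp up_hcp_neg_fcc up_hcp_neg_hcp
  up_fcc_pos_fcc up_fcc_pos_hcp up_fcc_neg_fcc up_fcc_neg_hcp up_fccNeg_pos_fcc up_fccNeg_pos_hcp up_fccNeg_neg_fcc up_fccNeg_neg_hcp
  up_hcpAlt_pos_fcc up_hcpAlt_pos_hcp up_hcpAlt_neg_fcc up_hcpAlt_neg_hcp)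
open Summit.AtomisticToContinuum.Crystallization.Theorems.OverbindingBudgetAffineCompressedCutCharts (mv ListedBy listedBy_fcc listedBy_hcp)
open Summit.AtomisticToContinuum.Crystallization.Theorems.OverbindingBudgetAffineCompressedCutEstablish (Estab estab_child_one)
open Summit.AtomisticToContinuum.Crystallization.Theorems.OverbindingBudgetAffineCompressedCutSeed (InLayer lnorm hexL_facts estab_mono
  eq_zero_of_lnorm_le lnorm_nonneg fcc_ne_hcp hexL_sub)
open Summit.AtomisticToContinuum.Crystallization.Theorems.OverbindingBudgetAffineCompressedCutSeedTwo (estab_site_unique)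
open Summit.AtomisticToContinuum.Crystallization.Theorems.OverbindingBudgetAffineCompressedCutStack (inLayer_tadd type_hcp_of_copy type_fcc_of_copy)
open Summit.AtomisticToContinuum.Crystallization.Theorems.OverbindingBudgetAffineCompressedCutStackTwo (copies_basic hexL_sub_shell kfNeg_fcc)
open Summit.AtomisticToContinuum.Crystallization.Theorems.OverbindingBudgetAffineCompressedCutPatch (InBox capv dL layer_climb_box tadd_tadd_assoc)

variable {N : ℕ}

/-! ## §1  Box connectivity -/

/-- ★ **BOX DESCENT.**  For layer points `x ≠ s` of one box there is a basal step `h ∈ hexL` with `x + h` in the box and at hex distance one less from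
`s` (boxes are products of coordinate intervals; move a coordinate above its target down by `3` and one below up by `3`). [this file] -/
theorem box_descent {o x s : T3} {K : ℤ} (hx : InLayer x) (hs : InLayer s) (hne : x ≠ s) (hxb : InBox o K x) (hsb : InBox o K s) :
    ∃ h ∈ hexL, InBox o K (tadd x h) ∧ lnorm (tsub (tadd x h) s) + 6 = lnorm (tsub x s) := by
  obtain ⟨x₁, x₂, x₃⟩ := x
  obtain ⟨s₁, s₂, s₃⟩ := s
  obtain ⟨o₁, o₂, o₃⟩ := o
  obtain ⟨hx0, hx1, hx2⟩ := hx
  obtain ⟨hs0, hs1, hs2⟩ := hs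
  simp only [InBox, abs_le] at hxb hsb
  dsimp only at hx0 hx1 hx2 hs0 hs1 hs2 hxb hsb
  have hne' : ¬ (x₁ = s₁ ∧ x₂ = s₂) := by
    rintro ⟨rfl, rfl⟩
    exact hne (by rw [show x₃ = s₃ by omega])
  rcases lt_trichotomy x₁ s₁ with h1 | h1 | h1
  · by_cases h2 : s₂ < x₂
    · exact ⟨(3, -3, 0), by decide, by simp only [InBox, tadd, abs_le]; omega,
        by simp only [lnorm, tsub, tadd, Int.abs_eq_natAbs]; omega⟩
    · exact ⟨(3, 0, -3), by decide, by simp only [InBox, tadd, abs_le]; omega,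
        by simp only [lnorm, tsub, tadd, Int.abs_eq_natAbs]; omega⟩
  · by_cases h2 : s₂ < x₂
    · exact ⟨(0, -3, 3), by decide, by simp only [InBox, tadd, abs_le]; omega,
        by simp only [lnorm, tsub, tadd, Int.abs_eq_natAbs]; omega⟩
    · exact ⟨(0, 3, -3), by decide, by simp only [InBox, tadd, abs_le]; omega,
        by simp only [lnorm, tsub, tadd, Int.abs_eq_natAbs]; omega⟩
  · by_cases h2 : x₂ < s₂
    · exact ⟨(-3, 3, 0), by decide, by simp only [InBox, tadd, abs_le]; omega,
        by simp only [lnorm, tsub, tadd, Int.abs_eq_natAbs]; omega⟩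
    · exact ⟨(-3, 0, 3), by decide, by simp only [InBox, tadd, abs_le]; omega,
        by simp only [lnorm, tsub, tadd, Int.abs_eq_natAbs]; omega⟩

/-- `x − s = 0 ⟹ x = s`. [this file] -/
theorem eq_of_tsub_eq_zero {x s : T3} (h : tsub x s = (0, 0, 0)) : x = s := by
  obtain ⟨x₁, x₂, x₃⟩ := x
  obtain ⟨s₁, s₂, s₃⟩ := s
  simp only [tsub, Prod.mk.injEq] at h ⊢
  omega

/-- `(x + h) + (−h) = x`. [this file] -/
theorem tadd_tadd_tneg (x h : T3) : tadd (tadd x h) (tneg h) = x := by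
  obtain ⟨x₁, x₂, x₃⟩ := x
  obtain ⟨h₁, h₂, h₃⟩ := h
  simp only [tadd, tneg, Prod.mk.injEq]
  omega

/-- `hexL` is closed under negation. [this file] -/
theorem tneg_mem_hexL : ∀ h ∈ hexL, tneg h ∈ hexL := by decide

/-! ## §2  One type, one copy per patch -/

/-- ★★ **PATCH UNIFORMITY (type propagation).**  See the module docstring.  Inputs: ball data; the climb output on the box (every layer point labels
an established site charted onto `Qa` if it is fcc, onto `Qb ∈ {H, H′}` if it is hcp; bounds `τ, D`, scales in `[ν, ν′]`); site identification
`(D + 10⁻⁴ν′ + τ) + D < ν`; ROOM on the box.  Output: one copy `C ∈ {Qa, Qb}` onto which EVERY site of the box is charted. [this file] -/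
theorem patch_uniform {y : Fin N → EuclideanSpace ℝ (Fin 3)} (hy : Function.Injective y) {r : ℝ} {i : Fin N}
    {A : Fin N → (EuclideanSpace ℝ (Fin 3) →ₗ[ℝ] EuclideanSpace ℝ (Fin 3))} {Qf : Fin N → (EuclideanSpace ℝ (Fin 3) →ₗᵢ[ℝ] EuclideanSpace ℝ (Fin 3))}
    {P : Fin N → Finset (EuclideanSpace ℝ (Fin 3))} {f : Fin N → EuclideanSpace ℝ (Fin 3) → EuclideanSpace ℝ (Fin 3)}
    {B : EuclideanSpace ℝ (Fin 3) →ₗ[ℝ] EuclideanSpace ℝ (Fin 3)}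
    (hP : ∀ j, dist (y j) (y i) ≤ r → (P j = fccTwoShellPattern ∨ P j = hcpTwoShellPattern))
    (hA : ∀ j, dist (y j) (y i) ≤ r → ∀ v ∈ P j, ‖A j v - Qf j v‖ ≤ 1 / 1000)
    (hf : ∀ j, dist (y j) (y i) ≤ r → ∀ v ∈ P j, f j v ∈ Set.range y ∧ dist (f j v) (y j + nearestDist y j • A j v) ≤ 1 / 10 ^ 4 * nearestDist y j)
    (hinj : ∀ j, dist (y j) (y i) ≤ r → Set.InjOn (f j) ↑(P j))
    (hex : ∀ j, dist (y j) (y i) ≤ r → ∀ m, m ≠ j → dist (y m) (y j) ≤ (3 / 2 + 1 / 450) * nearestDist y j → ∃ v ∈ P j, f j v = y m)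
    {Qa Qb : List T3} (hQb : Qb = hcpL ∨ Qb = hcpAltL) {lam o : T3} {K : ℤ} {τ D ν ν' : ℝ}
    (hout : ∀ x, InLayer x → InBox o K x → ∃ k : Fin N, ∃ M : EuclideanSpace ℝ (Fin 3) →ₗᵢ[ℝ] EuclideanSpace ℝ (Fin 3), ∃ Q : List T3,
      dist (y k) (y i) ≤ r ∧ ν ≤ nearestDist y k ∧ nearestDist y k ≤ ν' ∧
      ((P k = fccTwoShellPattern ∧ Q ∈ [Qa]) ∨ (P k = hcpTwoShellPattern ∧ Q ∈ [Qb])) ∧ Estab y A P B i k M Q (tadd lam x) τ D)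
    (hid : (D + 1 / 10 ^ 4 * ν' + τ) + D < ν)
    (hroom : ∀ x, InLayer x → InBox o K x → ‖B (mv (tadd lam x))‖ + (D + 1 / 10 ^ 4 * ν' + τ) ≤ r) :
    ∃ C : List T3, (C = Qa ∨ C = Qb) ∧ ∀ x, InLayer x → InBox o K x →
      ∃ k : Fin N, ∃ M : EuclideanSpace ℝ (Fin 3) →ₗᵢ[ℝ] EuclideanSpace ℝ (Fin 3),
        dist (y k) (y i) ≤ r ∧ ν ≤ nearestDist y k ∧ nearestDist y k ≤ ν' ∧ Estab y A P B i k M C (tadd lam x) τ D := by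
  obtain ⟨hKf, hKh, hhexQb⟩ :=
    Summit.AtomisticToContinuum.Crystallization.Theorems.OverbindingBudgetAffineCompressedCutOffDisc.e1_tables hQb
  have hlh : ∀ Q ∈ [Qb], Q.length ≤ 18 := by
    intro Q hQ
    rw [List.mem_singleton] at hQ
    rw [hQ]
    rcases hQb with rfl | rfl <;> decide
  -- the hcp predicate at a label and its propagation along a basal step
  have prop : ∀ x' g : T3, g ∈ hexL → InLayer (tadd x' g) → InBox o K (tadd x' g) →
      (∃ k : Fin N, ∃ M : EuclideanSpace ℝ (Fin 3) →ₗᵢ[ℝ] EuclideanSpace ℝ (Fin 3), dist (y k) (y i) ≤ r ∧ ν ≤ nearestDist y k ∧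
        nearestDist y k ≤ ν' ∧ P k = hcpTwoShellPattern ∧ Estab y A P B i k M Qb (tadd lam x') τ D) →
      ∃ k : Fin N, ∃ M : EuclideanSpace ℝ (Fin 3) →ₗᵢ[ℝ] EuclideanSpace ℝ (Fin 3), dist (y k) (y i) ≤ r ∧ ν ≤ nearestDist y k ∧
        nearestDist y k ≤ ν' ∧ P k = hcpTwoShellPattern ∧ Estab y A P B i k M Qb (tadd lam (tadd x' g)) τ D := by
    rintro x' g hg hxg hbg ⟨k', M', hk', hν, hν', -, hE'⟩
    obtain ⟨-, hg18⟩ := hexL_facts g hg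
    obtain ⟨k, M, Q, hk, hνk, hνk', hPQ, hE⟩ := hout (tadd x' g) hxg hbg
    have hlab : tadd (tadd lam x') g = tadd lam (tadd x' g) := tadd_tadd_assoc lam x' g
    have hball : ‖B (mv (tadd (tadd lam x') g))‖ + (D + 1 / 10 ^ 4 * nearestDist y k' + τ) ≤ r := by
      rw [hlab]
      linarith [hroom (tadd x' g) hxg hbg]
    obtain ⟨k'', v, -, -, -, -, -, -, -, R₁, -, Q'', hPQ'', hE''⟩ :=
      estab_child_one hy hP hA hf hinj hex hk' hE' (hhexQb g hg) hg18 (xs := hexL) hg hKf hKh (by simp) hlh hball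
    rw [hlab] at hE''
    have hkk : k'' = k := estab_site_unique hE'' hE (by linarith)
    have hPk : P k = hcpTwoShellPattern := by
      rcases hPQ'' with ⟨-, hQ⟩ | ⟨hPh, -⟩
      · simp at hQ
      · rw [← hkk]; exact hPh
    rcases hPQ with ⟨hPf, -⟩ | ⟨-, hQ⟩
    · exact absurd (hPf.symm.trans hPk) fcc_ne_hcp
    · rw [List.mem_singleton] at hQ
      rw [hQ] at hE
      exact ⟨k, M, hk, hνk, hνk', hPk, hE⟩
  by_cases hex0 : ∃ x₀, InLayer x₀ ∧ InBox o K x₀ ∧ ∃ k : Fin N, ∃ M : EuclideanSpace ℝ (Fin 3) →ₗᵢ[ℝ] EuclideanSpace ℝ (Fin 3),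
      dist (y k) (y i) ≤ r ∧ ν ≤ nearestDist y k ∧ nearestDist y k ≤ ν' ∧ P k = hcpTwoShellPattern ∧ Estab y A P B i k M Qb (tadd lam x₀) τ D
  · -- an hcp site somewhere: every site of the box is hcp and charted onto `Qb`
    obtain ⟨x₀, hx₀, hb₀, hH₀⟩ := hex0
    refine ⟨Qb, Or.inr rfl, ?_⟩
    suffices h : ∀ d : ℕ, ∀ x, InLayer x → InBox o K x → lnorm (tsub x x₀) ≤ 6 * (d : ℤ) →
        ∃ k : Fin N, ∃ M : EuclideanSpace ℝ (Fin 3) →ₗᵢ[ℝ] EuclideanSpace ℝ (Fin 3), dist (y k) (y i) ≤ r ∧ ν ≤ nearestDist y k ∧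
          nearestDist y k ≤ ν' ∧ P k = hcpTwoShellPattern ∧ Estab y A P B i k M Qb (tadd lam x) τ D by
      intro x hx hb
      have h0 := lnorm_nonneg (tsub x x₀)
      obtain ⟨k, M, hk, hν, hν', -, hE⟩ := h (lnorm (tsub x x₀)).toNat x hx hb (by rw [Int.toNat_of_nonneg h0]; linarith)
      exact ⟨k, M, hk, hν, hν', hE⟩
    intro d
    induction d with
    | zero =>
      intro x hx hb hl
      have hxx : x = x₀ := eq_of_tsub_eq_zero (eq_zero_of_lnorm_le _ (by simpa using hl))
      rw [hxx]; exact hH₀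
    | succ d ih =>
      intro x hx hb hl
      by_cases hxx : x = x₀
      · rw [hxx]; exact hH₀
      obtain ⟨h, hh, hbh, hdesc⟩ := box_descent hx hx₀ hxx hb hb₀
      have hxh : InLayer (tadd x h) := inLayer_tadd hx (hexL_facts h hh).1
      have hl' : lnorm (tsub (tadd x h) x₀) ≤ 6 * (d : ℤ) := by push_cast at hl; linarith
      have hH := ih (tadd x h) hxh hbh hl'
      have hback : tadd (tadd x h) (tneg h) = x := tadd_tadd_tneg x h
      have h2 := prop (tadd x h) (tneg h) (tneg_mem_hexL h hh) (by rw [hback]; exact hx) (by rw [hback]; exact hb) hH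
      rw [hback] at h2
      exact h2
  · -- no hcp site: every site of the box is fcc and charted onto `Qa`
    refine ⟨Qa, Or.inl rfl, fun x hx hb => ?_⟩
    obtain ⟨k, M, Q, hk, hν, hν', hPQ, hE⟩ := hout x hx hb
    rcases hPQ with ⟨-, hQ⟩ | ⟨hPh, hQ⟩
    · rw [List.mem_singleton] at hQ
      rw [hQ] at hE
      exact ⟨k, M, hk, hν, hν', hE⟩
    · rw [List.mem_singleton] at hQ
      rw [hQ] at hE
      exact absurd ⟨x, hx, hb, k, M, hk, hν, hν', hPh, hE⟩ hex0

/-! ## §3  The box climb from every aligned copy -/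

/-- ★ **BOX CLIMB FROM THE FOUR COPIES.**  `…Patch.layer_climb_box` from parent copy `C ∈ {F⁺, F⁻, H, H′}` and side `sg = ±1` with the record
tables: the cap sign `ε` (checked against `capL C sg` by `decide`), the in-layer row, the two-parent rows `up_*`.  ROOM is asked for both signs (the
caller does not know `ε` in advance).  Output: `ε`, the cap facts, the two singleton copies `Qa` (fcc children), `Qb ∈ {H, H′}` (hcp children) of
the rows, and the child box established at labels `λ₀ + capv sg ε (1,1,−2) + x`. [this file] -/
theorem layer_climb_box_four {y : Fin N → EuclideanSpace ℝ (Fin 3)} (hy : Function.Injective y) {r : ℝ} {i : Fin N}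
    {A : Fin N → (EuclideanSpace ℝ (Fin 3) →ₗ[ℝ] EuclideanSpace ℝ (Fin 3))} {Qf : Fin N → (EuclideanSpace ℝ (Fin 3) →ₗᵢ[ℝ] EuclideanSpace ℝ (Fin 3))}
    {P : Fin N → Finset (EuclideanSpace ℝ (Fin 3))} {f : Fin N → EuclideanSpace ℝ (Fin 3) → EuclideanSpace ℝ (Fin 3)}
    {B : EuclideanSpace ℝ (Fin 3) →ₗ[ℝ] EuclideanSpace ℝ (Fin 3)} {β : ℝ}
    (hP : ∀ j, dist (y j) (y i) ≤ r → (P j = fccTwoShellPattern ∨ P j = hcpTwoShellPattern))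
    (hA : ∀ j, dist (y j) (y i) ≤ r → ∀ v ∈ P j, ‖A j v - Qf j v‖ ≤ 1 / 1000)
    (hf : ∀ j, dist (y j) (y i) ≤ r → ∀ v ∈ P j, f j v ∈ Set.range y ∧ dist (f j v) (y j + nearestDist y j • A j v) ≤ 1 / 10 ^ 4 * nearestDist y j)
    (hinj : ∀ j, dist (y j) (y i) ≤ r → Set.InjOn (f j) ↑(P j))
    (hex : ∀ j, dist (y j) (y i) ≤ r → ∀ m, m ≠ j → dist (y m) (y j) ≤ (3 / 2 + 1 / 450) * nearestDist y j → ∃ v ∈ P j, f j v = y m)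
    (hB : ∀ z, β * ‖z‖ ≤ ‖B z‖) {C : List T3} (hC : C ∈ [fccL, fccNegL, hcpL, hcpAltL]) {sg : ℤ} (hsg : sg = 1 ∨ sg = -1)
    {lam₀ o : T3} (ho : thsum o = 0) {K : ℤ} (hK : 2 ≤ K) {τ D ν ν' : ℝ}
    (hpar : ∀ z, InLayer z → InBox o K z → ∃ k : Fin N, ∃ M : EuclideanSpace ℝ (Fin 3) →ₗᵢ[ℝ] EuclideanSpace ℝ (Fin 3),
      dist (y k) (y i) ≤ r ∧ ν ≤ nearestDist y k ∧ nearestDist y k ≤ ν' ∧ Estab y A P B i k M C (tadd lam₀ z) τ D)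
    (hΔ : 2 * D + 1 / 10 ^ 4 * ν' + τ < ν) (hsmall : (2 * τ + 5 / 2 * (3 / 10 ^ 4 * ν')) * Real.sqrt 2 < β)
    (hΔk : 2 * D + 2 / 10 ^ 4 * ν' + 2 * τ < 9967 / 10000 * ν)
    (hroom : ∀ ε : ℤ, (ε = 1 ∨ ε = -1) → (∀ δ ∈ dL, capv sg ε δ ∈ capL C sg) →
      ∀ x, InLayer x → InBox (tadd o (capv 0 ε (1, 1, -2))) (K - 1) x →
        ‖B (mv (tadd (tadd lam₀ (capv sg ε (1, 1, -2))) x))‖ + (D + 1 / 10 ^ 4 * ν' + τ) ≤ r) :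
    ∃ ε : ℤ, (ε = 1 ∨ ε = -1) ∧ (∀ δ ∈ dL, capv sg ε δ ∈ capL C sg) ∧
      ∃ Qa Qb : List T3, Qa ∈ [fccL, fccNegL, hcpL, hcpAltL] ∧ (Qb = hcpL ∨ Qb = hcpAltL) ∧
      ∀ x, InLayer x → InBox (tadd o (capv 0 ε (1, 1, -2))) (K - 1) x →
        ∃ k : Fin N, ∃ M : EuclideanSpace ℝ (Fin 3) →ₗᵢ[ℝ] EuclideanSpace ℝ (Fin 3), ∃ Q : List T3,
          dist (y k) (y i) ≤ r ∧ 9967 / 10000 * ν ≤ nearestDist y k ∧ nearestDist y k ≤ 10011 / 10000 * ν' ∧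
          ((P k = fccTwoShellPattern ∧ Q ∈ [Qa]) ∨ (P k = hcpTwoShellPattern ∧ Q ∈ [Qb])) ∧
          Estab y A P B i k M Q (tadd (tadd lam₀ (capv sg ε (1, 1, -2))) x)
            (τ + 5 / 2 * (2 * (1 / 10 ^ 4) * ν' + 1 / 10 ^ 4 * (10011 / 10000 * ν'))) (D + 1 / 10 ^ 4 * ν' + τ) := by
  have four_f : fccL ∈ [fccL, fccNegL, hcpL, hcpAltL] := by simp
  have four_n : fccNegL ∈ [fccL, fccNegL, hcpL, hcpAltL] := by simp
  -- listing models of the four copies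
  have hTf : ∀ Cf : List T3, (Cf = fccL ∨ Cf = fccNegL) → ∀ k, dist (y k) (y i) ≤ r →
      ∀ (M : EuclideanSpace ℝ (Fin 3) →ₗᵢ[ℝ] EuclideanSpace ℝ (Fin 3)) (lam : T3) (τ D : ℝ), Estab y A P B i k M Cf lam τ D → ListedBy (P k) fccL :=
    fun Cf hCf k hk M lam τ D hE => by rw [type_fcc_of_copy (hP k hk) hCf hE.1]; exact listedBy_fcc
  have hTh : ∀ Ch : List T3, (Ch = hcpL ∨ Ch = hcpAltL) → ∀ k, dist (y k) (y i) ≤ r →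
      ∀ (M : EuclideanSpace ℝ (Fin 3) →ₗᵢ[ℝ] EuclideanSpace ℝ (Fin 3)) (lam : T3) (τ D : ℝ), Estab y A P B i k M Ch lam τ D → ListedBy (P k) hcpL :=
    fun Ch hCh k hk M lam τ D hE => by rw [type_hcp_of_copy (hP k hk) hCh hE.1]; exact listedBy_hcp
  simp only [List.mem_cons, List.not_mem_nil, or_false] at hC
  rcases hC with rfl | rfl | rfl | rfl
  · -- `F⁺`
    rcases hsg with rfl | rfl
    · have hc : ∀ δ ∈ dL, capv 1 1 δ ∈ capL fccL 1 := by decide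
      exact ⟨1, Or.inl rfl, hc, fccL, hcpAltL, four_f, Or.inr rfl,
        layer_climb_box hy hP hA hf hinj hex hB (C := fccL) (by simp) (S₁ := fccL) (Or.inl rfl) (hTf fccL (Or.inl rfl)) (xs := fccShellL)
          hexL_sub_shell kf_fcc (by simp) (Or.inl rfl) (Or.inl rfl) hc up_fcc_pos_fcc up_fcc_pos_hcp (by decide) (by decide) ho hK hpar hΔ
          hsmall hΔk (hroom 1 (Or.inl rfl) hc)⟩
    · have hc : ∀ δ ∈ dL, capv (-1) (-1) δ ∈ capL fccL (-1) := by decide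
      exact ⟨-1, Or.inr rfl, hc, fccL, hcpL, four_f, Or.inl rfl,
        layer_climb_box hy hP hA hf hinj hex hB (C := fccL) (by simp) (S₁ := fccL) (Or.inl rfl) (hTf fccL (Or.inl rfl)) (xs := fccShellL)
          hexL_sub_shell kf_fcc (by simp) (Or.inr rfl) (Or.inr rfl) hc up_fcc_neg_fcc up_fcc_neg_hcp (by decide) (by decide) ho hK hpar hΔ
          hsmall hΔk (hroom (-1) (Or.inr rfl) hc)⟩
  · -- `F⁻`
    rcases hsg with rfl | rfl
    · have hc : ∀ δ ∈ dL, capv 1 (-1) δ ∈ capL fccNegL 1 := by decide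
      exact ⟨-1, Or.inr rfl, hc, fccNegL, hcpL, four_n, Or.inl rfl,
        layer_climb_box hy hP hA hf hinj hex hB (C := fccNegL) (by simp) (S₁ := fccL) (Or.inl rfl) (hTf fccNegL (Or.inr rfl)) (xs := hexL)
          (fun h hh => hh) kfNeg_fcc (by simp) (Or.inl rfl) (Or.inr rfl) hc up_fccNeg_pos_fcc up_fccNeg_pos_hcp (by decide) (by decide) ho
          hK hpar hΔ hsmall hΔk (hroom (-1) (Or.inr rfl) hc)⟩
    · have hc : ∀ δ ∈ dL, capv (-1) 1 δ ∈ capL fccNegL (-1) := by decide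
      exact ⟨1, Or.inl rfl, hc, fccNegL, hcpAltL, four_n, Or.inr rfl,
        layer_climb_box hy hP hA hf hinj hex hB (C := fccNegL) (by simp) (S₁ := fccL) (Or.inl rfl) (hTf fccNegL (Or.inr rfl)) (xs := hexL)
          (fun h hh => hh) kfNeg_fcc (by simp) (Or.inr rfl) (Or.inl rfl) hc up_fccNeg_neg_fcc up_fccNeg_neg_hcp (by decide) (by decide) ho
          hK hpar hΔ hsmall hΔk (hroom 1 (Or.inl rfl) hc)⟩
  · -- `H`
    rcases hsg with rfl | rfl
    · have hc : ∀ δ ∈ dL, capv 1 1 δ ∈ capL hcpL 1 := by decide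
      exact ⟨1, Or.inl rfl, hc, fccL, hcpAltL, four_f, Or.inr rfl,
        layer_climb_box hy hP hA hf hinj hex hB (C := hcpL) (by simp) (S₁ := hcpL) (Or.inr rfl) (hTh hcpL (Or.inl rfl)) (xs := hexL)
          (fun h hh => hh) e1_entries.2.1 (by simp) (Or.inl rfl) (Or.inl rfl) hc up_hcp_pos_fcc up_hcp_pos_hcp (by decide) (by decide) ho hK
          hpar hΔ hsmall hΔk (hroom 1 (Or.inl rfl) hc)⟩
    · have hc : ∀ δ ∈ dL, capv (-1) 1 δ ∈ capL hcpL (-1) := by decide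
      exact ⟨1, Or.inl rfl, hc, fccNegL, hcpAltL, four_n, Or.inr rfl,
        layer_climb_box hy hP hA hf hinj hex hB (C := hcpL) (by simp) (S₁ := hcpL) (Or.inr rfl) (hTh hcpL (Or.inl rfl)) (xs := hexL)
          (fun h hh => hh) e1_entries.2.1 (by simp) (Or.inr rfl) (Or.inl rfl) hc up_hcp_neg_fcc up_hcp_neg_hcp (by decide) (by decide) ho hK
          hpar hΔ hsmall hΔk (hroom 1 (Or.inl rfl) hc)⟩
  · -- `H′`
    rcases hsg with rfl | rfl
    · have hc : ∀ δ ∈ dL, capv 1 (-1) δ ∈ capL hcpAltL 1 := by decide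
      exact ⟨-1, Or.inr rfl, hc, fccNegL, hcpL, four_n, Or.inl rfl,
        layer_climb_box hy hP hA hf hinj hex hB (C := hcpAltL) (by simp) (S₁ := hcpL) (Or.inr rfl) (hTh hcpAltL (Or.inr rfl)) (xs := hexL)
          (fun h hh => hh) e1_entries.2.2.2 (by simp) (Or.inl rfl) (Or.inr rfl) hc up_hcpAlt_pos_fcc up_hcpAlt_pos_hcp (by decide) (by decide)
          ho hK hpar hΔ hsmall hΔk (hroom (-1) (Or.inr rfl) hc)⟩
    · have hc : ∀ δ ∈ dL, capv (-1) (-1) δ ∈ capL hcpAltL (-1) := by decide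
      exact ⟨-1, Or.inr rfl, hc, fccL, hcpL, four_f, Or.inl rfl,
        layer_climb_box hy hP hA hf hinj hex hB (C := hcpAltL) (by simp) (S₁ := hcpL) (Or.inr rfl) (hTh hcpAltL (Or.inr rfl)) (xs := hexL)
          (fun h hh => hh) e1_entries.2.2.2 (by simp) (Or.inr rfl) (Or.inr rfl) hc up_hcpAlt_neg_fcc up_hcpAlt_neg_hcp (by decide) (by decide)
          ho hK hpar hΔ hsmall hΔk (hroom (-1) (Or.inr rfl) hc)⟩

end Summit.AtomisticToContinuum.Crystallization.Theorems.OverbindingBudgetAffineCompressedCutPatchTwo
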